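import Summits.QuantumFields.YangMills.Theorems.BalabanLadderUVSeamRecOddCycleChessboard

/-!
# Odd-cycle chessboard WITHOUT block divisibility — part IIa: the pair potential and its reflection-positivity identity

Helper file (`--supports stmt-QuantumFields-20043`, count-neutral) of seat `ym-infvol-p3` g10, continuing
`Theorems/BalabanLadderUVSeamRecOddCycleChessboard.lean` (part I: the extremal reduction «reachability of `∅` ⇒
chessboard bound» on the cycle `ℤ/(2S+1)` with slabs of width `w` at arbitrary positions).  HONEST FRAMING:
finite combinatorics / reflection-positivity bookkeeping; nothing about the universal bound, E0′, the gap or Clay.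

CONTENT.  For a valid reflection `x` of a configuration `A` write `A = P ⊔ R` (`P` = slabs in the closed positive half).
The PAIR POTENTIAL `pot A = Σ_{a ≠ b ∈ A} 2^{(2S+1) − (b − a).val}` obeys the exact identity
`pot (symP w x A) + pot (symM w x A) − 2·pot A = 2^{w−1}(X₁ − Y₁)² + 2^{w}(X₂ − Y₂)²`
(`pot_symP_add_pot_symM`; `X₁ = Σ_{a∈P} 2^{(a−x).val}`, `Y₁ = Σ_{b∈R} 2^{(refl b − x).val}`, and `X₂`, `Y₂` the same
sums with exponents `S+1−w−·`) — the kernel `2^{N−d}` is reflection positive on the cycle because every cross term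
factors through the offsets from `x` (`val_cross_pp/mm/pm`, `crossT_eq`).  By binary expansion
(`Finset.geomSum_injective`) `X₁ = Y₁` forces `P = refl(R)`, i.e. `x` is a SYMMETRY AXIS of `A` (`isSymm_of_sum_eq`);
hence at a valid reflection that is not a symmetry axis one of the two symmetrisations has strictly larger potential
(`pot_lt_of_not_isSymm`).  Part IIb (`…OddCycleChessboardReach.lean`) turns this into the reachability of `∅` and the
final chessboard bound.

References: J. Fröhlich, R. Israel, E. H. Lieb, B. Simon, Commun. Math. Phys. 62 (1978) 1–34 (the classical estimate,
even side and block divisibility); this generalisation (no divisibility) is not in the cited sources.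
-/

set_option autoImplicit false

noncomputable section

open Finset

namespace Summit.QuantumFields.YangMills.Theorems.OddCycleChessboard

/-! ## §3 Part II — the combinatorial reachability: every non-dense compatible configuration reaches `∅`

Potential argument.  For a valid reflection `x` of `A` split `A = P ⊔ R` (`P` = slabs in the closed positive half).
(1) If `#P ≠ #R` the lighter symmetrisation has fewer slabs (and is non-empty unless `A` sits in one closed half, which
reaches `∅` in one move).  (2) If `#P = #R`, the PAIR POTENTIAL `pot A = Σ_{a ≠ b ∈ A} 2^{N − (b−a).val}` satisfies the
exact identity `pot (symP) + pot (symM) − 2·pot A = 2^{w−1}(X₁−Y₁)² + 2^{w}(X₂−Y₂)²` (reflection positivity of the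
kernel `2^{N−d}` on the cycle: the cross terms factor through the offsets from `x`), where `X₁ = Σ_{a∈P} 2^{(a−x).val}`
and `Y₁ = Σ_{b∈R} 2^{(refl b − x).val}`; so one side has strictly larger potential unless `X₁ = Y₁`, which by binary
expansion (`Finset.geomSum_injective`) forces `P = refl(R)`, i.e. `x` is a SYMMETRY AXIS of `A`.  (3) If every valid
reflection is a symmetry axis, two of them generate a translation `δ ≠ 0` stabilising `A`, and `x ↦ a₀ + 2(x − x₀)`
injects the valid reflections into `A`: `#valid ≤ #A`; but at most `(2w−3)·#A` reflections are invalid, so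
`N ≤ (2w−2)·#A` — `A` is dense.  Hence every non-dense non-empty compatible `A` has a progressing move, and by
induction on `(#A, pot)` it reaches `∅`. -/

section Reach

variable {S w : ℕ}

/-- **Symmetry axis**: the reflection `x` maps the configuration `A` into (hence onto) itself. -/
def IsSymm (w : ℕ) (x : ZMod (2 * S + 1)) (A : Finset (ZMod (2 * S + 1))) : Prop :=
  ∀ a ∈ A, refl w x a ∈ A

/-- **The pair potential** `pot A = Σ_{a ≠ b ∈ A} 2^{(2S+1) − (b − a).val}`. -/
def pot (A : Finset (ZMod (2 * S + 1))) : ℕ :=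
  ∑ a ∈ A, ∑ b ∈ A, if a = b then 0 else 2 ^ (2 * S + 1 - (b - a).val)

/-- The cross kernel of two slabs with positive offsets summing to `U`: `2^{U+w−1} + 2^{2S+2−w−U}`. -/
def crossT (S w U : ℕ) : ℕ := 2 ^ (U + w - 1) + 2 ^ (2 * S + 2 - w - U)

/-- `pot` of a disjoint union. -/
theorem pot_union {P Q : Finset (ZMod (2 * S + 1))} (h : Disjoint P Q) :
    pot (P ∪ Q) = pot P + pot Q +
      ∑ a ∈ P, ∑ b ∈ Q, (2 ^ (2 * S + 1 - (b - a).val) + 2 ^ (2 * S + 1 - (a - b).val)) := by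
  classical
  have hPQ : ∑ a ∈ P, ∑ b ∈ Q, (if a = b then 0 else 2 ^ (2 * S + 1 - (b - a).val)) =
      ∑ a ∈ P, ∑ b ∈ Q, 2 ^ (2 * S + 1 - (b - a).val) := by
    refine sum_congr rfl fun a ha => sum_congr rfl fun b hb => ?_
    rw [if_neg (fun hab : a = b => disjoint_left.1 h ha (hab ▸ hb))]
  have hQP : ∑ a ∈ Q, ∑ b ∈ P, (if a = b then 0 else 2 ^ (2 * S + 1 - (b - a).val)) =
      ∑ a ∈ P, ∑ b ∈ Q, 2 ^ (2 * S + 1 - (a - b).val) := by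
    rw [sum_comm]
    refine sum_congr rfl fun a ha => sum_congr rfl fun b hb => ?_
    rw [if_neg (fun hba : b = a => disjoint_left.1 h ha (hba ▸ hb))]
  unfold pot
  rw [sum_union h]
  simp_rw [sum_union h]
  rw [sum_add_distrib, sum_add_distrib, hPQ, hQP]
  simp only [sum_add_distrib]
  ring

/-- `pot` is invariant under the mirror map `refl w x`. -/
theorem pot_image_refl (w : ℕ) (x : ZMod (2 * S + 1)) (P : Finset (ZMod (2 * S + 1))) :
    pot (P.image (refl w x)) = pot P := by
  classical
  unfold pot
  rw [sum_image (fun a _ b _ h => refl_injective w x h)]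
  simp_rw [sum_image (fun a _ b _ h => refl_injective w x h)]
  rw [sum_comm]
  refine sum_congr rfl fun a _ => sum_congr rfl fun b _ => ?_
  by_cases hab : b = a
  · subst hab; simp
  · rw [if_neg (fun h => hab (refl_injective w x h)), if_neg (fun h => hab h.symm), refl_sub_refl w x b a]

/-- `pot` of a symmetrisation `P ∪ refl(P)` (disjoint): twice `pot P` plus the cross terms over `P × P`. -/
theorem pot_union_image_refl (w : ℕ) (x : ZMod (2 * S + 1)) {P : Finset (ZMod (2 * S + 1))}
    (h : Disjoint P (P.image (refl w x))) :
    pot (P ∪ P.image (refl w x)) = 2 * pot P +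
      ∑ a ∈ P, ∑ b ∈ P, (2 ^ (2 * S + 1 - (refl w x b - a).val) + 2 ^ (2 * S + 1 - (a - refl w x b).val)) := by
  classical
  rw [pot_union h, pot_image_refl]
  simp_rw [sum_image (fun a _ b _ h => refl_injective w x h)]
  ring

/-- Cross values, positive–positive: for slabs `a`, `b` in the closed positive half,
`(refl b − a).val = 2S+2−w−u_b−u_a` and `(a − refl b).val = u_a+u_b+w−1` (`u = (· − x).val`). -/
theorem val_cross_pp (hw : 2 ≤ w) {x a b : ZMod (2 * S + 1)} (ha : InPlus w x a) (hb : InPlus w x b) :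
    (refl w x b - a).val = 2 * S + 2 - w - (b - x).val - (a - x).val ∧
      (a - refl w x b).val = (a - x).val + (b - x).val + w - 1 := by
  have hrb := val_refl_sub hw (x := x) (a := b) (by unfold InPlus at hb; omega)
  unfold InPlus at ha hb
  constructor
  · rw [val_sub_eq_offsets x a (refl w x b), hrb]; split_ifs with h <;> omega
  · rw [val_sub_eq_offsets x (refl w x b) a, hrb]; split_ifs with h <;> omega

/-- Cross values, negative–negative: for slabs `b`, `b'` in the closed negative half, with `õ = (refl · − x).val`,
`(refl b' − b).val = õ_b + õ_{b'} + w − 1` and `(b − refl b').val = 2S+2−w−õ_b−õ_{b'}`. -/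
theorem val_cross_mm (hw : 2 ≤ w) {x b b' : ZMod (2 * S + 1)} (hb : InMinus w x b) (hb' : InMinus w x b') :
    (refl w x b' - b).val = (refl w x b - x).val + (refl w x b' - x).val + w - 1 ∧
      (b - refl w x b').val = 2 * S + 2 - w - (refl w x b - x).val - (refl w x b' - x).val := by
  have hrb := val_refl_sub hw (x := x) (a := b) (by unfold InMinus at hb; omega)
  have hrb' := val_refl_sub hw (x := x) (a := b') (by unfold InMinus at hb'; omega)
  unfold InMinus at hb hb'
  constructor
  · rw [val_sub_eq_offsets x b (refl w x b'), hrb', hrb]; split_ifs with h <;> omega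
  · rw [val_sub_eq_offsets x (refl w x b') b, hrb', hrb]; split_ifs with h <;> omega

/-- Cross values, positive–negative: for `a` in the positive and `b` in the negative closed half,
`(b − a).val = 2S+2−w−õ_b−u_a` and `(a − b).val = u_a + õ_b + w − 1`. -/
theorem val_cross_pm (hw : 2 ≤ w) {x a b : ZMod (2 * S + 1)} (ha : InPlus w x a) (hb : InMinus w x b) :
    (b - a).val = 2 * S + 2 - w - (refl w x b - x).val - (a - x).val ∧
      (a - b).val = (a - x).val + (refl w x b - x).val + w - 1 := by
  have hrb := val_refl_sub hw (x := x) (a := b) (by unfold InMinus at hb; omega)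
  unfold InPlus at ha; unfold InMinus at hb
  constructor
  · rw [val_sub_eq_offsets x a b, hrb]; split_ifs with h <;> omega
  · rw [val_sub_eq_offsets x b a, hrb]; split_ifs with h <;> omega

/-- **Factorisation of the cross kernel**: for offsets `o, o' ≤ S+1−w` (`w ≥ 1`),
`crossT S w (o+o') = 2^{w−1}·2^o·2^{o'} + 2^w·2^{S+1−w−o}·2^{S+1−w−o'}`. -/
theorem crossT_eq (hw : 1 ≤ w) {o o' : ℕ} (ho : o + w ≤ S + 1) (ho' : o' + w ≤ S + 1) :
    crossT S w (o + o') = 2 ^ (w - 1) * (2 ^ o * 2 ^ o') + 2 ^ w * (2 ^ (S + 1 - w - o) * 2 ^ (S + 1 - w - o')) := by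
  unfold crossT
  rw [← pow_add, ← pow_add, ← pow_add, ← pow_add]
  congr 1 <;> congr 1 <;> omega

/-- **Double sums of the cross kernel factor**: `Σ_{a∈P} Σ_{b∈Q} crossT (o a + o' b) = 2^{w−1} X Y + 2^w X' Y'`. -/
theorem sum_sum_crossT (hw : 1 ≤ w) {P Q : Finset (ZMod (2 * S + 1))} {o : ZMod (2 * S + 1) → ℕ}
    {o' : ZMod (2 * S + 1) → ℕ} (ho : ∀ a ∈ P, o a + w ≤ S + 1) (ho' : ∀ b ∈ Q, o' b + w ≤ S + 1) :
    ∑ a ∈ P, ∑ b ∈ Q, crossT S w (o a + o' b) =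
      2 ^ (w - 1) * ((∑ a ∈ P, 2 ^ o a) * ∑ b ∈ Q, 2 ^ o' b) +
        2 ^ w * ((∑ a ∈ P, 2 ^ (S + 1 - w - o a)) * ∑ b ∈ Q, 2 ^ (S + 1 - w - o' b)) := by
  rw [sum_mul_sum, sum_mul_sum, mul_sum, mul_sum, ← sum_add_distrib]
  refine sum_congr rfl fun a ha => ?_
  rw [mul_sum, mul_sum, ← sum_add_distrib]
  refine sum_congr rfl fun b hb => ?_
  exact crossT_eq hw (ho a ha) (ho' b hb)

/-- **The reflection-positivity identity for the pair potential.**  At a valid reflection `x` of `A` (`w ≥ 2`), with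
`P = A.filter (InPlus w x)`, `R` the rest, `X₁ = Σ_{P} 2^{(a−x).val}`, `Y₁ = Σ_{R} 2^{(refl b − x).val}`,
`X₂ = Σ_{P} 2^{S+1−w−(a−x).val}`, `Y₂ = Σ_{R} 2^{S+1−w−(refl b−x).val}`:
`pot (symP) + pot (symM) + 2^{w} X₁ Y₁ + 2^{w+1} X₂ Y₂ = 2 pot A + 2^{w−1}(X₁² + Y₁²) + 2^{w}(X₂² + Y₂²)`,
i.e. `pot (symP) + pot (symM) − 2 pot A = 2^{w−1}(X₁ − Y₁)² + 2^{w}(X₂ − Y₂)²`. -/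
theorem pot_symP_add_pot_symM (hw : 2 ≤ w) {x : ZMod (2 * S + 1)} {A : Finset (ZMod (2 * S + 1))}
    (hv : Valid w x A) :
    ((pot (symP w x A) : ℤ) + pot (symM w x A)) - 2 * pot A =
      2 ^ (w - 1) * ((∑ a ∈ A.filter (InPlus w x), (2 : ℤ) ^ (a - x).val) -
          ∑ b ∈ A.filter (fun a => ¬ InPlus w x a), (2 : ℤ) ^ (refl w x b - x).val) ^ 2 +
      2 ^ w * ((∑ a ∈ A.filter (InPlus w x), (2 : ℤ) ^ (S + 1 - w - (a - x).val)) -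
          ∑ b ∈ A.filter (fun a => ¬ InPlus w x a), (2 : ℤ) ^ (S + 1 - w - (refl w x b - x).val)) ^ 2 := by
  classical
  set P := A.filter (InPlus w x) with hP
  set R := A.filter (fun a => ¬ InPlus w x a) with hR
  have hPp : ∀ a ∈ P, InPlus w x a := fun a ha => (mem_filter.1 ha).2
  have hRm : ∀ b ∈ R, InMinus w x b := fun b hb => (hv b (mem_filter.1 hb).1).resolve_left (mem_filter.1 hb).2
  have hoP : ∀ a ∈ P, (a - x).val + w ≤ S + 1 := fun a ha => by have := hPp a ha; unfold InPlus at this; omega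
  have hoR : ∀ b ∈ R, (refl w x b - x).val + w ≤ S + 1 := fun b hb => by
    have := inPlus_refl_of_inMinus hw (hRm b hb); unfold InPlus at this; omega
  -- disjointness
  have hdisjP : Disjoint P (P.image (refl w x)) := by
    rw [disjoint_left]; intro c hc hc'
    obtain ⟨b, hb, rfl⟩ := mem_image.1 hc'
    exact not_inPlus_of_inMinus (by omega) (inMinus_refl_of_inPlus hw (hPp b hb)) (hPp _ hc)
  have hdisjR : Disjoint R (R.image (refl w x)) := by
    rw [disjoint_left]; intro c hc hc'
    obtain ⟨b, hb, rfl⟩ := mem_image.1 hc'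
    exact (mem_filter.1 hc).2 (inPlus_refl_of_inMinus hw (hRm b hb))
  have hdisjPR : Disjoint P R := disjoint_filter_filter_not A A (InPlus w x)
  have hA : A = P ∪ R := (filter_union_filter_not_eq (InPlus w x) A).symm
  -- the three expansions
  have h1 : pot (symP w x A) = 2 * pot P + ∑ a ∈ P, ∑ b ∈ P, crossT S w ((a - x).val + (b - x).val) := by
    rw [symP, ← hP, pot_union_image_refl w x hdisjP]
    congr 1
    refine sum_congr rfl fun a ha => sum_congr rfl fun b hb => ?_
    obtain ⟨h₁, h₂⟩ := val_cross_pp hw (hPp a ha) (hPp b hb)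
    have := hoP a ha; have := hoP b hb
    rw [h₁, h₂, crossT]; congr 1 <;> congr 1 <;> omega
  have h2 : pot (symM w x A) = 2 * pot R +
      ∑ b ∈ R, ∑ b' ∈ R, crossT S w ((refl w x b - x).val + (refl w x b' - x).val) := by
    rw [symM, ← hR, pot_union_image_refl w x hdisjR]
    congr 1
    refine sum_congr rfl fun b hb => sum_congr rfl fun b' hb' => ?_
    obtain ⟨h₁, h₂⟩ := val_cross_mm hw (hRm b hb) (hRm b' hb')
    have := hoR b hb; have := hoR b' hb'
    rw [h₁, h₂, crossT, add_comm]; congr 1 <;> congr 1 <;> omega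
  have h3 : pot A = pot P + pot R + ∑ a ∈ P, ∑ b ∈ R, crossT S w ((a - x).val + (refl w x b - x).val) := by
    rw [hA, pot_union hdisjPR]
    congr 1
    refine sum_congr rfl fun a ha => sum_congr rfl fun b hb => ?_
    obtain ⟨h₁, h₂⟩ := val_cross_pm hw (hPp a ha) (hRm b hb)
    have := hoP a ha; have := hoR b hb
    rw [h₁, h₂, crossT]; congr 1 <;> congr 1 <;> omega
  rw [h1, h2, h3, sum_sum_crossT (by omega) hoP hoP, sum_sum_crossT (by omega) hoR hoR,
    sum_sum_crossT (by omega) hoP hoR]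
  push_cast
  ring

/-- **Equal binary sums force symmetry**: at a valid reflection, `X₁ = Y₁` implies that `x` is a symmetry axis. -/
theorem isSymm_of_sum_eq {x : ZMod (2 * S + 1)} {A : Finset (ZMod (2 * S + 1))}
    (hv : Valid w x A)
    (heq : ∑ a ∈ A.filter (InPlus w x), (2 : ℤ) ^ (a - x).val =
      ∑ b ∈ A.filter (fun a => ¬ InPlus w x a), (2 : ℤ) ^ (refl w x b - x).val) :
    IsSymm w x A := by
  classical
  set P := A.filter (InPlus w x) with hP
  set R := A.filter (fun a => ¬ InPlus w x a) with hR
  have hRm : ∀ b ∈ R, InMinus w x b := fun b hb => (hv b (mem_filter.1 hb).1).resolve_left (mem_filter.1 hb).2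
  -- exponent sets
  have hinjP : Set.InjOn (fun a : ZMod (2 * S + 1) => (a - x).val) P := fun a _ b _ h => by
    simpa using ZMod.val_injective _ h
  have hinjR : Set.InjOn (fun b : ZMod (2 * S + 1) => (refl w x b - x).val) R := fun a _ b _ h => by
    have h' : refl w x a - x = refl w x b - x := ZMod.val_injective _ h
    exact refl_injective w x (by simpa using h')
  have hE : P.image (fun a => (a - x).val) = R.image (fun b => (refl w x b - x).val) := by
    apply Finset.geomSum_injective (n := 2) le_rfl
    have h1 := sum_image (f := fun e : ℕ => (2 : ℤ) ^ e) hinjP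
    have h2 := sum_image (f := fun e : ℕ => (2 : ℤ) ^ e) hinjR
    have : ((∑ i ∈ P.image (fun a => (a - x).val), 2 ^ i : ℕ) : ℤ) =
        ((∑ i ∈ R.image (fun b => (refl w x b - x).val), 2 ^ i : ℕ) : ℤ) := by
      push_cast; rw [h1, h2]; exact heq
    exact_mod_cast this
  -- P = refl(R)
  have hPR : ∀ a ∈ P, ∃ b ∈ R, refl w x b = a := by
    intro a ha
    have : (a - x).val ∈ R.image (fun b => (refl w x b - x).val) := hE ▸ mem_image_of_mem _ ha
    obtain ⟨b, hb, hba⟩ := mem_image.1 this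
    exact ⟨b, hb, by simpa using (ZMod.val_injective _ hba : refl w x b - x = a - x)⟩
  have hRP : ∀ b ∈ R, refl w x b ∈ P := by
    intro b hb
    have : (refl w x b - x).val ∈ P.image (fun a => (a - x).val) := hE ▸ mem_image_of_mem _ hb
    obtain ⟨a, ha, hab⟩ := mem_image.1 this
    have : a - x = refl w x b - x := ZMod.val_injective _ hab
    have : a = refl w x b := by simpa using this
    exact this ▸ ha
  intro a ha
  by_cases hap : InPlus w x a
  · obtain ⟨b, hb, rfl⟩ := hPR _ (mem_filter.2 ⟨ha, hap⟩)
    rw [refl_refl]; exact (mem_filter.1 hb).1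
  · exact (mem_filter.1 (hRP a (mem_filter.2 ⟨ha, hap⟩))).1

/-- **Progress at a balanced non-symmetry axis**: one of the two symmetrisations has strictly larger potential. -/
theorem pot_lt_of_not_isSymm (hw : 2 ≤ w) {x : ZMod (2 * S + 1)} {A : Finset (ZMod (2 * S + 1))}
    (hv : Valid w x A) (hns : ¬ IsSymm w x A) :
    pot A < pot (symP w x A) ∨ pot A < pot (symM w x A) := by
  have hid := pot_symP_add_pot_symM hw hv
  have hne : (∑ a ∈ A.filter (InPlus w x), (2 : ℤ) ^ (a - x).val) -
      ∑ b ∈ A.filter (fun a => ¬ InPlus w x a), (2 : ℤ) ^ (refl w x b - x).val ≠ 0 :=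
    fun h => hns (isSymm_of_sum_eq hv (sub_eq_zero.1 h))
  have hsq : 0 < ((∑ a ∈ A.filter (InPlus w x), (2 : ℤ) ^ (a - x).val) -
      ∑ b ∈ A.filter (fun a => ¬ InPlus w x a), (2 : ℤ) ^ (refl w x b - x).val) ^ 2 := by positivity
  have hpos : (0 : ℤ) < ((pot (symP w x A) : ℤ) + pot (symM w x A)) - 2 * pot A := by
    rw [hid]
    have h1 : (0 : ℤ) < 2 ^ (w - 1) * ((∑ a ∈ A.filter (InPlus w x), (2 : ℤ) ^ (a - x).val) -
      ∑ b ∈ A.filter (fun a => ¬ InPlus w x a), (2 : ℤ) ^ (refl w x b - x).val) ^ 2 :=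
      mul_pos (pow_pos (by norm_num) _) hsq
    have h2 : (0 : ℤ) ≤ 2 ^ w * ((∑ a ∈ A.filter (InPlus w x), (2 : ℤ) ^ (S + 1 - w - (a - x).val)) -
          ∑ b ∈ A.filter (fun a => ¬ InPlus w x a), (2 : ℤ) ^ (S + 1 - w - (refl w x b - x).val)) ^ 2 := by
      positivity
    linarith
  by_contra h
  push Not at h
  have h1 : (pot (symP w x A) : ℤ) ≤ pot A := by exact_mod_cast h.1
  have h2 : (pot (symM w x A) : ℤ) ≤ pot A := by exact_mod_cast h.2
  linarith


end Reach

end Summit.QuantumFields.YangMills.Theorems.OddCycleChessboard
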